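import Summits.AtomisticToContinuum.Crystallization.Theses.HullExactificationCascade
import Summits.AtomisticToContinuum.Crystallization.Theorems.HullExactificationCascadeRobustBarlowTemplateDefs
import Summits.AtomisticToContinuum.Crystallization.Theorems.HullExactificationCascadeHcpLandscapeGapGlueCore
import Summits.AtomisticToContinuum.Crystallization.Theorems.HullExactificationCascadeHcpLandscapeGapStubBoxMinimiserRigid
import Summits.AtomisticToContinuum.Crystallization.Theorems.HullExactificationCascadeHcpLandscapeGapStubShellGeometry

/-!
# Route HullExactificationCascade — crux B `HcpLandscapeGap` (stmt-AtomisticToContinuum-12087) from TEMPLATED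
# defect-counting coercivity at the relaxed-hcp minimiser (line `birth`, lead c4)

The landed reduction `HcpLandscapeGap_of_hcpDefectCounting : HcpBulkFloor → HcpDefectCoercivity → HcpLandscapeGap`
(p149126) never uses B's own hypotheses that `S` is everywhere `1/20`-good and Barlow-templated: it applies the
sibling cruxes of route HcpDefectCounting (stmt-14477, stmt-14476) to the finite windows `S ∩ B̄_L(c)` and discards
the rest.  This file records, kernel-checked, the dependency B actually has.  ONE hypothesis suffices:

**templated defect-counting coercivity at the box minimiser** — for `(a,h)` minimising `e_LJ(hcp a h)` over B's box
(`9/10 < a < 1`, `|h − a√(2/3)| ≤ a/100`) and all `δ, θ > 0` there are `κ > 0`, `C` such that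
`n·e_LJ(hcp a h) + κ·#{i : ¬Good(4,θ,i)} ≤ 𝓔_LJ(x) + C(L+1)²` for every injective enumeration `x` of a window
`S ∩ B̄_L(c)` (`L ≥ 0`) of a δ-separated, everywhere `1/20`-good, Barlow-templated `S` (`Good(4,θ,i)` exactly as in
stmt-14476, relative to the finite cluster `x`).

It contains the templated bulk floor (`κ ≥ 0`) and is implied by `HcpBulkFloor ∧ HcpDefectCoercivity`
(`templatedCoercivity_of_hcpDefectCounting`, allowance `C = 0`, via the landed rigidity of the box minimiser),
but contains neither the energy→twelve-coordination content of 14476 (`stub_shellTier` of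
`Cruxes/HcpDefectCoercivity/Lines/birth.lean`, where the TetrahedralFrustration / IcosahedralClusters barriers bite)
nor the non-close-packed periodic competitors of 14477/3062: in route HullExactificationCascade that content is crux
A's (`ZeroDefectDensity`) and crux C's (`RobustBarlowTemplate`).  What it does contain is the nonlinear elastic +
stacking stability of Lennard-Jones hcp inside the `1/20`-templated class, with `O((L+1)²)` boundary bookkeeping.

Proofs: `master_of` / `stackingFaultPrice_of_glue` / `elasticCoercivity_of_glue` / `HcpLandscapeGap_of_PNE`
(landed, lead c3) re-run AT the given `(a,h)` with the admissibility hypotheses threaded through to the point where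
the coercivity is applied to the window and the allowance added to the boundary constant; the witness of B is the
landed box minimiser (`stub_boxMinimiser`), enclosed at `(0.97129, 0.79294) ± 10⁻⁴` by `stub_boxMinimiserRigid`,
where `stub_shellGeometry` applies.  The registered stub `HcpLandscapeGap_of_templatedCoercivity` states the
hypothesis in the vocabulary `Sep` / `Good` / `idealStacking` / `LocSim` of
`HullExactificationCascadeRobustBarlowTemplateDefs` (definitionally B's inline clauses).  [folklore bookkeeping]
-/

namespace Summit.AtomisticToContinuum.Crystallization.Theorems.HcpLandscapeGapBirth

/-- **Master priced inequality from templated coercivity AT `(a,h)`** (cf. `master_of`): boundary-layer estimate →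
for enclosed `(a,h)` carrying the templated coercivity and any priced predicate killed by `Good(4,θ)`, the master
inequality for admissible `S`. [folklore] -/
theorem masterT_at : (∀ δ : ℝ, 0 < δ → ∀ ρ : ℝ, 0 ≤ ρ → ∃ C : ℝ, ∀ S : Set (EuclideanSpace ℝ (Fin 3)), (∀ y ∈ S, ∀ z ∈ S, y ≠ z → δ ≤ dist y z) → ∀ (c : EuclideanSpace ℝ (Fin 3)) (L : ℝ), 0 ≤ L → (({y : EuclideanSpace ℝ (Fin 3) | y ∈ S ∧ dist y c ≤ L ∧ L - ρ < dist y c} : Set (EuclideanSpace ℝ (Fin 3))).ncard : ℝ) ≤ C * (L + 1) ^ 2 ∧ ∀ (n : ℕ) (x : Fin n → EuclideanSpace ℝ (Fin 3)), Function.Injective x → Set.range x = {y : EuclideanSpace ℝ (Fin 3) | y ∈ S ∧ dist y c ≤ L} → 2 * Literature.MathematicalPhysics.StatisticalMechanics.interactionEnergy Literature.MathematicalPhysics.StatisticalMechanics.lennardJones x - C * (L + 1) ^ 2 ≤ (∑' y : ↥{y : EuclideanSpace ℝ (Fin 3) | y ∈ S ∧ dist y c ≤ L}, (∑' z : ↥{z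 : EuclideanSpace ℝ (Fin 3) | z ∈ S ∧ z ≠ (y : EuclideanSpace ℝ (Fin 3))}, Literature.MathematicalPhysics.StatisticalMechanics.lennardJones (dist (y : EuclideanSpace ℝ (Fin 3)) (z : EuclideanSpace ℝ (Fin 3)))))) → ∀ (a h : ℝ) (ha : a ≠ 0) (hh : h ≠ 0), (|a - 97129 / 100000| ≤ 1 / 10000 ∧ |h - 79294 / 100000| ≤ 1 / 10000) → (∀ δ θ : ℝ, 0 < δ → 0 < θ → ∃ κ : ℝ, 0 < κ ∧ ∃ C : ℝ, ∀ S : Set (EuclideanSpace ℝ (Fin 3)), (∀ y ∈ S, ∀ z ∈ S, y ≠ z → δ ≤ dist y z) → (∀ y ∈ S, (let d : ℝ := sInf ((fun z => dist z y) '' (S \ {y})); let T : Set (EuclideanSpace ℝ (Fin 3)) := {z : EuclideanSpace ℝ (Fin 3) | z ∈ S ∧ z ≠ y ∧ dist z y < 13 / 10 * d}; ∃ A : EuclideanSpace ℝ (Fin 3) →ₗᵢ[ℝ] EuclideanSpace ℝ (Fin 3), (∃ e : ↥T ≃ ↥Literature.Geometry.DiscreteGeometry.fccKissingPattern, ∀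 t : ↥T, dist (d⁻¹ • ((t : EuclideanSpace ℝ (Fin 3)) - y)) (A ((e t : ↥Literature.Geometry.DiscreteGeometry.fccKissingPattern) : EuclideanSpace ℝ (Fin 3))) ≤ 1 / 20) ∨ (∃ e : ↥T ≃ ↥Literature.Geometry.DiscreteGeometry.hcpKissingPattern, ∀ t : ↥T, dist (d⁻¹ • ((t : EuclideanSpace ℝ (Fin 3)) - y)) (A ((e t : ↥Literature.Geometry.DiscreteGeometry.hcpKissingPattern) : EuclideanSpace ℝ (Fin 3))) ≤ 1 / 20))) → (∃ s : ℤ → ℤ, Literature.MathematicalPhysics.StatisticalMechanics.IsHaggSeq s ∧ ∃ Φ : EuclideanSpace ℝ (Fin 3) → EuclideanSpace ℝ (Fin 3), Set.BijOn Φ (Literature.MathematicalPhysics.StatisticalMechanics.barlowStacking 1 (Real.sqrt (2 / 3)) s) S ∧ ∀ p ∈ Literature.MathematicalPhysics.StatisticalMechanics.barlowStacking 1 (Real.sqrt (2 / 3)) s, ∃ A : EuclideanSpace ℝ (Fin 3) →ₗᵢ[ℝ] EuclideanSpace ℝ (Fin 3), ∃ l : ℝ, 0 < l ∧ ∀ q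 ∈ Literature.MathematicalPhysics.StatisticalMechanics.barlowStacking 1 (Real.sqrt (2 / 3)) s, dist q p ≤ 1 → dist (Φ q) (Φ p + l • A (q - p)) ≤ 1 / 20 * l) → ∀ (c : EuclideanSpace ℝ (Fin 3)) (L : ℝ), 0 ≤ L → ∀ (n : ℕ) (x : Fin n → EuclideanSpace ℝ (Fin 3)), Function.Injective x → Set.range x = {y : EuclideanSpace ℝ (Fin 3) | y ∈ S ∧ dist y c ≤ L} → (n : ℝ) * (Literature.MathematicalPhysics.StatisticalMechanics.hcpPeriodicConfiguration ha hh).energyPerParticle Literature.MathematicalPhysics.StatisticalMechanics.lennardJones + κ * (Nat.card {i : Fin n // ¬ (∃ A : EuclideanSpace ℝ (Fin 3) →ₗᵢ[ℝ] EuclideanSpace ℝ (Fin 3), (∀ p ∈ (Literature.MathematicalPhysics.StatisticalMechanics.hcpPeriodicConfiguration ha hh).points, ‖p‖ ≤ 4 → ∃ j : Fin n, dist (x j) (x i + A p) ≤ θ) ∧ (∀ j : Fin n, dist (x j) (x i) ≤ 4 → ∃ p ∈ (Literature.MathematicalPhysics.StatisticalMechanics.hcpPeriodicConfiguration ha hh).points,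 dist (x j) (x i + A p) ≤ θ))} : ℝ) ≤ Literature.MathematicalPhysics.StatisticalMechanics.interactionEnergy Literature.MathematicalPhysics.StatisticalMechanics.lennardJones x + C * (L + 1) ^ 2) → ∀ δ : ℝ, 0 < δ → ∀ θ : ℝ, 0 < θ → ∀ Bad : Set (EuclideanSpace ℝ (Fin 3)) → EuclideanSpace ℝ (Fin 3) → Prop, (∀ S : Set (EuclideanSpace ℝ (Fin 3)), (∀ y ∈ S, ∀ z ∈ S, y ≠ z → δ ≤ dist y z) → ∀ y ∈ S, (∃ A : EuclideanSpace ℝ (Fin 3) →ₗᵢ[ℝ] EuclideanSpace ℝ (Fin 3), (∀ p ∈ (Literature.MathematicalPhysics.StatisticalMechanics.hcpPeriodicConfiguration ha hh).points, ‖p‖ ≤ 4 → ∃ z ∈ S, dist z (y + A p) ≤ θ) ∧ (∀ z ∈ S, dist z y ≤ 4 → ∃ p ∈ (Literature.MathematicalPhysics.StatisticalMechanics.hcpPeriodicConfiguration ha hh).points, dist z (y + A p) ≤ θ)) → ¬ Bad S y) → ∃ κ : ℝ, 0 < κ ∧ ∃ C : ℝ, ∀ S : Set (EuclideanSpace ℝ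 (Fin 3)), (∀ y ∈ S, ∀ z ∈ S, y ≠ z → δ ≤ dist y z) → (∀ y ∈ S, (let d : ℝ := sInf ((fun z => dist z y) '' (S \ {y})); let T : Set (EuclideanSpace ℝ (Fin 3)) := {z : EuclideanSpace ℝ (Fin 3) | z ∈ S ∧ z ≠ y ∧ dist z y < 13 / 10 * d}; ∃ A : EuclideanSpace ℝ (Fin 3) →ₗᵢ[ℝ] EuclideanSpace ℝ (Fin 3), (∃ e : ↥T ≃ ↥Literature.Geometry.DiscreteGeometry.fccKissingPattern, ∀ t : ↥T, dist (d⁻¹ • ((t : EuclideanSpace ℝ (Fin 3)) - y)) (A ((e t : ↥Literature.Geometry.DiscreteGeometry.fccKissingPattern) : EuclideanSpace ℝ (Fin 3))) ≤ 1 / 20) ∨ (∃ e : ↥T ≃ ↥Literature.Geometry.DiscreteGeometry.hcpKissingPattern, ∀ t : ↥T, dist (d⁻¹ • ((t : EuclideanSpace ℝ (Fin 3)) - y)) (A ((e t : ↥Literature.Geometry.DiscreteGeometry.hcpKissingPattern) : EuclideanSpace ℝ (Fin 3))) ≤ 1 / 20))) → (∃ s : ℤ → ℤ, Literature.MathematicalPhysics.StatisticalMechanics.IsHaggSeq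 s ∧ ∃ Φ : EuclideanSpace ℝ (Fin 3) → EuclideanSpace ℝ (Fin 3), Set.BijOn Φ (Literature.MathematicalPhysics.StatisticalMechanics.barlowStacking 1 (Real.sqrt (2 / 3)) s) S ∧ ∀ p ∈ Literature.MathematicalPhysics.StatisticalMechanics.barlowStacking 1 (Real.sqrt (2 / 3)) s, ∃ A : EuclideanSpace ℝ (Fin 3) →ₗᵢ[ℝ] EuclideanSpace ℝ (Fin 3), ∃ l : ℝ, 0 < l ∧ ∀ q ∈ Literature.MathematicalPhysics.StatisticalMechanics.barlowStacking 1 (Real.sqrt (2 / 3)) s, dist q p ≤ 1 → dist (Φ q) (Φ p + l • A (q - p)) ≤ 1 / 20 * l) → ∀ (c : EuclideanSpace ℝ (Fin 3)) (L : ℝ), 0 ≤ L → 2 * ((Literature.MathematicalPhysics.StatisticalMechanics.hcpPeriodicConfiguration ha hh).energyPerParticle Literature.MathematicalPhysics.StatisticalMechanics.lennardJones) * (({y : EuclideanSpace ℝ (Fin 3) | y ∈ S ∧ dist y c ≤ L} : Set (EuclideanSpace ℝ (Fin 3))).ncard : ℝ) + κ * (({y : EuclideanSpace ℝ (Fin 3)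 | y ∈ S ∧ dist y c ≤ L ∧ Bad S y} : Set (EuclideanSpace ℝ (Fin 3))).ncard : ℝ) - C * (L + 1) ^ 2 ≤ (∑' y : ↥{y : EuclideanSpace ℝ (Fin 3) | y ∈ S ∧ dist y c ≤ L}, (∑' z : ↥{z : EuclideanSpace ℝ (Fin 3) | z ∈ S ∧ z ≠ (y : EuclideanSpace ℝ (Fin 3))}, Literature.MathematicalPhysics.StatisticalMechanics.lennardJones (dist (y : EuclideanSpace ℝ (Fin 3)) (z : EuclideanSpace ℝ (Fin 3))))) := by
  intro hL
  classical
  intro a h ha hh henc hK δ hδ θ hθ Bad hBad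
  -- the templated defect-counting coercivity at (a, h)
  obtain ⟨κ₀, hκ₀, C₀, hcoer⟩ := hK δ θ hδ hθ
  -- the boundary layer at depth 5
  obtain ⟨C₁, hC₁⟩ := hL δ hδ 5 (by norm_num)
  refine ⟨2 * κ₀, by positivity, C₁ + 2 * κ₀ * C₁ + 2 * C₀, ?_⟩
  intro S hsep hgood htempl c L hL0
  obtain ⟨hlayer, hcross⟩ := hC₁ S hsep c L hL0
  set W : Set (EuclideanSpace ℝ (Fin 3)) := {y | y ∈ S ∧ dist y c ≤ L} with hW
  have hWfin : W.Finite :=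
    Literature.MathematicalPhysics.StatisticalMechanics.finite_of_forall_le_dist_of_subset_closedBall hδ
      (fun p hp q hq hpq => hsep p hp.1 q hq.1 hpq) (c := c) (R := L)
      (fun p hp => Metric.mem_closedBall.2 hp.2)
  obtain ⟨n, f, hf⟩ := hWfin.fin_embedding
  have hxW : ∀ i, f i ∈ W := fun i => hf ▸ Set.mem_range_self i
  have hncard : (W.ncard : ℝ) = n := by
    rw [← hf, Set.ncard_range_of_injective f.injective, Nat.card_eq_fintype_card, Fintype.card_fin]
  -- templated coercivity on the window
  have hK2 : (n : ℝ) * (Literature.MathematicalPhysics.StatisticalMechanics.hcpPeriodicConfiguration ha hh).energyPerParticle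
        Literature.MathematicalPhysics.StatisticalMechanics.lennardJones +
      κ₀ * (Nat.card {i : Fin n // ¬ (∃ A : EuclideanSpace ℝ (Fin 3) →ₗᵢ[ℝ] EuclideanSpace ℝ (Fin 3),
        (∀ p ∈ (Literature.MathematicalPhysics.StatisticalMechanics.hcpPeriodicConfiguration ha hh).points,
          ‖p‖ ≤ 4 → ∃ j : Fin n, dist (f j) (f i + A p) ≤ θ) ∧
        (∀ j : Fin n, dist (f j) (f i) ≤ 4 →
          ∃ p ∈ (Literature.MathematicalPhysics.StatisticalMechanics.hcpPeriodicConfiguration ha hh).points,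
            dist (f j) (f i + A p) ≤ θ))} : ℝ) ≤
      Literature.MathematicalPhysics.StatisticalMechanics.interactionEnergy
        Literature.MathematicalPhysics.StatisticalMechanics.lennardJones f + C₀ * (L + 1) ^ 2 :=
    hcoer S hsep hgood htempl c L hL0 n f f.injective hf
  set NG : Set (Fin n) := {i | ¬ (∃ A : EuclideanSpace ℝ (Fin 3) →ₗᵢ[ℝ] EuclideanSpace ℝ (Fin 3),
        (∀ p ∈ (Literature.MathematicalPhysics.StatisticalMechanics.hcpPeriodicConfiguration ha hh).points,
          ‖p‖ ≤ 4 → ∃ j : Fin n, dist (f j) (f i + A p) ≤ θ) ∧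
        (∀ j : Fin n, dist (f j) (f i) ≤ 4 →
          ∃ p ∈ (Literature.MathematicalPhysics.StatisticalMechanics.hcpPeriodicConfiguration ha hh).points,
            dist (f j) (f i + A p) ≤ θ))} with hNG
  set Lay : Set (EuclideanSpace ℝ (Fin 3)) := {y | y ∈ S ∧ dist y c ≤ L ∧ L - 5 < dist y c} with hLay
  set B : Set (EuclideanSpace ℝ (Fin 3)) := {y | y ∈ S ∧ dist y c ≤ L ∧ Bad S y} with hB
  have hcardNG : (Nat.card {i : Fin n // ¬ (∃ A : EuclideanSpace ℝ (Fin 3) →ₗᵢ[ℝ] EuclideanSpace ℝ (Fin 3),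
        (∀ p ∈ (Literature.MathematicalPhysics.StatisticalMechanics.hcpPeriodicConfiguration ha hh).points,
          ‖p‖ ≤ 4 → ∃ j : Fin n, dist (f j) (f i + A p) ≤ θ) ∧
        (∀ j : Fin n, dist (f j) (f i) ≤ 4 →
          ∃ p ∈ (Literature.MathematicalPhysics.StatisticalMechanics.hcpPeriodicConfiguration ha hh).points,
            dist (f j) (f i + A p) ≤ θ))} : ℝ) = (NG.ncard : ℝ) := by
    rw [← Nat.card_coe_set_eq, hNG, Set.coe_setOf]
  have hsub : B ⊆ (fun i => (f i : EuclideanSpace ℝ (Fin 3))) '' NG ∪ Lay := by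
    intro y hy
    obtain ⟨hyS, hyL, hyBad⟩ := hy
    by_cases hdepth : L - 5 < dist y c
    · exact Or.inr ⟨hyS, hyL, hdepth⟩
    · push Not at hdepth
      have hyW : y ∈ Set.range f := hf ▸ (⟨hyS, hyL⟩ : y ∈ W)
      obtain ⟨i, rfl⟩ := hyW
      refine Or.inl ⟨i, ?_, rfl⟩
      intro hgoodi
      obtain ⟨A, hA1, hA2⟩ := hgoodi
      refine hBad S hsep (f i) hyS ⟨A, ?_, ?_⟩ hyBad
      · intro p hp hp4
        obtain ⟨j, hj⟩ := hA1 p hp hp4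
        exact ⟨f j, (hxW j).1, hj⟩
      · intro z hz hz4
        have hzW : z ∈ W := by
          refine ⟨hz, ?_⟩
          calc dist z c ≤ dist z (f i) + dist (f i) c := dist_triangle _ _ _
            _ ≤ 4 + (L - 5) := add_le_add hz4 hdepth
            _ ≤ L := by linarith
        have hzr : z ∈ Set.range f := hf ▸ hzW
        obtain ⟨j, rfl⟩ := hzr
        exact hA2 j hz4
  have hLayfin : Lay.Finite := hWfin.subset fun y hy => ⟨hy.1, hy.2.1⟩
  have hNGfin : NG.Finite := Set.toFinite NG
  have hBle : (B.ncard : ℝ) ≤ (NG.ncard : ℝ) + (Lay.ncard : ℝ) := by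
    have h1 : B.ncard ≤ ((fun i => (f i : EuclideanSpace ℝ (Fin 3))) '' NG ∪ Lay).ncard :=
      Set.ncard_le_ncard hsub ((hNGfin.image _).union hLayfin)
    have h2 := Set.ncard_union_le ((fun i => (f i : EuclideanSpace ℝ (Fin 3))) '' NG) Lay
    have h3 : ((fun i => (f i : EuclideanSpace ℝ (Fin 3))) '' NG).ncard ≤ NG.ncard := Set.ncard_image_le hNGfin
    exact_mod_cast h1.trans (h2.trans (Nat.add_le_add_right h3 _))
  have hcross' := hcross n f f.injective hf
  have hNG0 : (0 : ℝ) ≤ (NG.ncard : ℝ) := Nat.cast_nonneg _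
  rw [hcardNG] at hK2
  rw [hncard]
  have hκC : 2 * κ₀ * (B.ncard : ℝ) ≤ 2 * κ₀ * (NG.ncard : ℝ) + 2 * κ₀ * (C₁ * (L + 1) ^ 2) := by
    have h1 : (B.ncard : ℝ) ≤ (NG.ncard : ℝ) + C₁ * (L + 1) ^ 2 := by linarith [hBle, hlayer]
    have h2 := mul_le_mul_of_nonneg_left h1 (by positivity : (0 : ℝ) ≤ 2 * κ₀)
    linarith [h2]
  linarith [hκC, hK2, hcross']

/-- **N at `(a,h)`, templated**: fcc-type sites of admissible `S` are priced (cf. `stackingFaultPrice_of_glue`).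
[folklore] -/
theorem stackingFaultPrice_at_of_templated : ∀ (a h : ℝ) (ha : a ≠ 0) (hh : h ≠ 0), (|a - 97129 / 100000| ≤ 1 / 10000 ∧ |h - 79294 / 100000| ≤ 1 / 10000) → (∀ δ θ : ℝ, 0 < δ → 0 < θ → ∃ κ : ℝ, 0 < κ ∧ ∃ C : ℝ, ∀ S : Set (EuclideanSpace ℝ (Fin 3)), (∀ y ∈ S, ∀ z ∈ S, y ≠ z → δ ≤ dist y z) → (∀ y ∈ S, (let d : ℝ := sInf ((fun z => dist z y) '' (S \ {y})); let T : Set (EuclideanSpace ℝ (Fin 3)) := {z : EuclideanSpace ℝ (Fin 3) | z ∈ S ∧ z ≠ y ∧ dist z y < 13 / 10 * d}; ∃ A : EuclideanSpace ℝ (Fin 3) →ₗᵢ[ℝ] EuclideanSpace ℝ (Fin 3), (∃ e : ↥T ≃ ↥Literature.Geometry.DiscreteGeometry.fccKissingPattern, ∀ t : ↥T, dist (d⁻¹ • ((t : EuclideanSpace ℝ (Fin 3)) - y)) (A ((e t : ↥Literature.Geometry.DiscreteGeometry.fccKissingPattern) : EuclideanSpace ℝ (Fin 3))) ≤ 1 /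 20) ∨ (∃ e : ↥T ≃ ↥Literature.Geometry.DiscreteGeometry.hcpKissingPattern, ∀ t : ↥T, dist (d⁻¹ • ((t : EuclideanSpace ℝ (Fin 3)) - y)) (A ((e t : ↥Literature.Geometry.DiscreteGeometry.hcpKissingPattern) : EuclideanSpace ℝ (Fin 3))) ≤ 1 / 20))) → (∃ s : ℤ → ℤ, Literature.MathematicalPhysics.StatisticalMechanics.IsHaggSeq s ∧ ∃ Φ : EuclideanSpace ℝ (Fin 3) → EuclideanSpace ℝ (Fin 3), Set.BijOn Φ (Literature.MathematicalPhysics.StatisticalMechanics.barlowStacking 1 (Real.sqrt (2 / 3)) s) S ∧ ∀ p ∈ Literature.MathematicalPhysics.StatisticalMechanics.barlowStacking 1 (Real.sqrt (2 / 3)) s, ∃ A : EuclideanSpace ℝ (Fin 3) →ₗᵢ[ℝ] EuclideanSpace ℝ (Fin 3), ∃ l : ℝ, 0 < l ∧ ∀ q ∈ Literature.MathematicalPhysics.StatisticalMechanics.barlowStacking 1 (Real.sqrt (2 / 3)) s, dist q p ≤ 1 → dist (Φ q) (Φ p + l • A (q - p)) ≤ 1 / 20 * l) → ∀ (c : EuclideanSpace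 ℝ (Fin 3)) (L : ℝ), 0 ≤ L → ∀ (n : ℕ) (x : Fin n → EuclideanSpace ℝ (Fin 3)), Function.Injective x → Set.range x = {y : EuclideanSpace ℝ (Fin 3) | y ∈ S ∧ dist y c ≤ L} → (n : ℝ) * (Literature.MathematicalPhysics.StatisticalMechanics.hcpPeriodicConfiguration ha hh).energyPerParticle Literature.MathematicalPhysics.StatisticalMechanics.lennardJones + κ * (Nat.card {i : Fin n // ¬ (∃ A : EuclideanSpace ℝ (Fin 3) →ₗᵢ[ℝ] EuclideanSpace ℝ (Fin 3), (∀ p ∈ (Literature.MathematicalPhysics.StatisticalMechanics.hcpPeriodicConfiguration ha hh).points, ‖p‖ ≤ 4 → ∃ j : Fin n, dist (x j) (x i + A p) ≤ θ) ∧ (∀ j : Fin n, dist (x j) (x i) ≤ 4 → ∃ p ∈ (Literature.MathematicalPhysics.StatisticalMechanics.hcpPeriodicConfiguration ha hh).points, dist (x j) (x i + A p) ≤ θ))} : ℝ) ≤ Literature.MathematicalPhysics.StatisticalMechanics.interactionEnergy Literature.MathematicalPhysics.StatisticalMechanics.lennardJones x + C * (L + 1) ^ 2) → ∀ δ : ℝ,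 0 < δ → ∃ κ : ℝ, 0 < κ ∧ ∃ C : ℝ, ∀ S : Set (EuclideanSpace ℝ (Fin 3)), (∀ y ∈ S, ∀ z ∈ S, y ≠ z → δ ≤ dist y z) → (∀ y ∈ S, (let d : ℝ := sInf ((fun z => dist z y) '' (S \ {y})); let T : Set (EuclideanSpace ℝ (Fin 3)) := {z : EuclideanSpace ℝ (Fin 3) | z ∈ S ∧ z ≠ y ∧ dist z y < 13 / 10 * d}; ∃ A : EuclideanSpace ℝ (Fin 3) →ₗᵢ[ℝ] EuclideanSpace ℝ (Fin 3), (∃ e : ↥T ≃ ↥Literature.Geometry.DiscreteGeometry.fccKissingPattern, ∀ t : ↥T, dist (d⁻¹ • ((t : EuclideanSpace ℝ (Fin 3)) - y)) (A ((e t : ↥Literature.Geometry.DiscreteGeometry.fccKissingPattern) : EuclideanSpace ℝ (Fin 3))) ≤ 1 / 20) ∨ (∃ e : ↥T ≃ ↥Literature.Geometry.DiscreteGeometry.hcpKissingPattern, ∀ t : ↥T, dist (d⁻¹ • ((t : EuclideanSpace ℝ (Fin 3)) - y)) (A ((e t : ↥Literature.Geometry.DiscreteGeometry.hcpKissingPattern)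 : EuclideanSpace ℝ (Fin 3))) ≤ 1 / 20))) → (∃ s : ℤ → ℤ, Literature.MathematicalPhysics.StatisticalMechanics.IsHaggSeq s ∧ ∃ Φ : EuclideanSpace ℝ (Fin 3) → EuclideanSpace ℝ (Fin 3), Set.BijOn Φ (Literature.MathematicalPhysics.StatisticalMechanics.barlowStacking 1 (Real.sqrt (2 / 3)) s) S ∧ ∀ p ∈ Literature.MathematicalPhysics.StatisticalMechanics.barlowStacking 1 (Real.sqrt (2 / 3)) s, ∃ A : EuclideanSpace ℝ (Fin 3) →ₗᵢ[ℝ] EuclideanSpace ℝ (Fin 3), ∃ l : ℝ, 0 < l ∧ ∀ q ∈ Literature.MathematicalPhysics.StatisticalMechanics.barlowStacking 1 (Real.sqrt (2 / 3)) s, dist q p ≤ 1 → dist (Φ q) (Φ p + l • A (q - p)) ≤ 1 / 20 * l) → ∀ (c : EuclideanSpace ℝ (Fin 3)) (L : ℝ), 0 ≤ L → 2 * ((Literature.MathematicalPhysics.StatisticalMechanics.hcpPeriodicConfiguration ha hh).energyPerParticle Literature.MathematicalPhysics.StatisticalMechanics.lennardJones) * (({y : EuclideanSpace ℝ (Fin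 3) | y ∈ S ∧ dist y c ≤ L} : Set (EuclideanSpace ℝ (Fin 3))).ncard : ℝ) + κ * (({y : EuclideanSpace ℝ (Fin 3) | y ∈ S ∧ dist y c ≤ L ∧ (let d : ℝ := sInf ((fun z => dist z y) '' (S \ {y})); let T : Set (EuclideanSpace ℝ (Fin 3)) := {z : EuclideanSpace ℝ (Fin 3) | z ∈ S ∧ z ≠ y ∧ dist z y < 13 / 10 * d}; ∃ A : EuclideanSpace ℝ (Fin 3) →ₗᵢ[ℝ] EuclideanSpace ℝ (Fin 3), ∃ e : ↥T ≃ ↥Literature.Geometry.DiscreteGeometry.fccKissingPattern, ∀ t : ↥T, dist (d⁻¹ • ((t : EuclideanSpace ℝ (Fin 3)) - y)) (A ((e t : ↥Literature.Geometry.DiscreteGeometry.fccKissingPattern) : EuclideanSpace ℝ (Fin 3))) ≤ 1 / 20)} : Set (EuclideanSpace ℝ (Fin 3))).ncard : ℝ) - C * (L + 1) ^ 2 ≤ (∑' y : ↥{y : EuclideanSpace ℝ (Fin 3) | y ∈ S ∧ dist y c ≤ L}, (∑' z : ↥{z : EuclideanSpace ℝ (Fin 3) | z ∈ S ∧ z ≠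 (y : EuclideanSpace ℝ (Fin 3))}, Literature.MathematicalPhysics.StatisticalMechanics.lennardJones (dist (y : EuclideanSpace ℝ (Fin 3)) (z : EuclideanSpace ℝ (Fin 3))))) := by
  intro a h ha hh henc hK δ hδ
  obtain ⟨θ, hθ, hgeo⟩ := stub_shellGeometry a h ha hh henc.1 henc.2 δ hδ 1 one_pos
  obtain ⟨κ, hκ, C, hC⟩ := masterT_at stub_boundaryLayer a h ha hh henc hK δ hδ θ hθ
    (fun S y => (let d : ℝ := sInf ((fun z => dist z y) '' (S \ {y})); let T : Set (EuclideanSpace ℝ (Fin 3)) := {z : EuclideanSpace ℝ (Fin 3) | z ∈ S ∧ z ≠ y ∧ dist z y < 13 / 10 * d}; ∃ A : EuclideanSpace ℝ (Fin 3) →ₗᵢ[ℝ] EuclideanSpace ℝ (Fin 3), ∃ e : ↥T ≃ ↥Literature.Geometry.DiscreteGeometry.fccKissingPattern, ∀ t : ↥T, dist (d⁻¹ • ((t : EuclideanSpace ℝ (Fin 3)) - y)) (A ((e t : ↥Literature.Geometry.DiscreteGeometry.fccKissingPattern) : EuclideanSpace ℝ (Fin 3))) ≤ 1 / 20))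
    (fun S hS y hy hGd => (hgeo S hS y hy hGd).2)
  exact ⟨κ, hκ, C, hC⟩

/-- **E at `(a,h)`, templated**: `η`-bad non-fcc-type sites of admissible `S` are priced (cf.
`elasticCoercivity_of_glue`). [folklore] -/
theorem elasticCoercivity_at_of_templated : ∀ (a h : ℝ) (ha : a ≠ 0) (hh : h ≠ 0), (|a - 97129 / 100000| ≤ 1 / 10000 ∧ |h - 79294 / 100000| ≤ 1 / 10000) → (∀ δ θ : ℝ, 0 < δ → 0 < θ → ∃ κ : ℝ, 0 < κ ∧ ∃ C : ℝ, ∀ S : Set (EuclideanSpace ℝ (Fin 3)), (∀ y ∈ S, ∀ z ∈ S, y ≠ z → δ ≤ dist y z) → (∀ y ∈ S, (let d : ℝ := sInf ((fun z => dist z y) '' (S \ {y})); let T : Set (EuclideanSpace ℝ (Fin 3)) := {z : EuclideanSpace ℝ (Fin 3) | z ∈ S ∧ z ≠ y ∧ dist z y < 13 / 10 * d}; ∃ A : EuclideanSpace ℝ (Fin 3) →ₗᵢ[ℝ] EuclideanSpace ℝ (Fin 3), (∃ e : ↥T ≃ ↥Literature.Geometry.DiscreteGeometry.fccKissingPattern,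 ∀ t : ↥T, dist (d⁻¹ • ((t : EuclideanSpace ℝ (Fin 3)) - y)) (A ((e t : ↥Literature.Geometry.DiscreteGeometry.fccKissingPattern) : EuclideanSpace ℝ (Fin 3))) ≤ 1 / 20) ∨ (∃ e : ↥T ≃ ↥Literature.Geometry.DiscreteGeometry.hcpKissingPattern, ∀ t : ↥T, dist (d⁻¹ • ((t : EuclideanSpace ℝ (Fin 3)) - y)) (A ((e t : ↥Literature.Geometry.DiscreteGeometry.hcpKissingPattern) : EuclideanSpace ℝ (Fin 3))) ≤ 1 / 20))) → (∃ s : ℤ → ℤ, Literature.MathematicalPhysics.StatisticalMechanics.IsHaggSeq s ∧ ∃ Φ : EuclideanSpace ℝ (Fin 3) → EuclideanSpace ℝ (Fin 3), Set.BijOn Φ (Literature.MathematicalPhysics.StatisticalMechanics.barlowStacking 1 (Real.sqrt (2 / 3)) s) S ∧ ∀ p ∈ Literature.MathematicalPhysics.StatisticalMechanics.barlowStacking 1 (Real.sqrt (2 / 3)) s, ∃ A : EuclideanSpace ℝ (Fin 3) →ₗᵢ[ℝ] EuclideanSpace ℝ (Fin 3), ∃ l : ℝ, 0 < l ∧ ∀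 q ∈ Literature.MathematicalPhysics.StatisticalMechanics.barlowStacking 1 (Real.sqrt (2 / 3)) s, dist q p ≤ 1 → dist (Φ q) (Φ p + l • A (q - p)) ≤ 1 / 20 * l) → ∀ (c : EuclideanSpace ℝ (Fin 3)) (L : ℝ), 0 ≤ L → ∀ (n : ℕ) (x : Fin n → EuclideanSpace ℝ (Fin 3)), Function.Injective x → Set.range x = {y : EuclideanSpace ℝ (Fin 3) | y ∈ S ∧ dist y c ≤ L} → (n : ℝ) * (Literature.MathematicalPhysics.StatisticalMechanics.hcpPeriodicConfiguration ha hh).energyPerParticle Literature.MathematicalPhysics.StatisticalMechanics.lennardJones + κ * (Nat.card {i : Fin n // ¬ (∃ A : EuclideanSpace ℝ (Fin 3) →ₗᵢ[ℝ] EuclideanSpace ℝ (Fin 3), (∀ p ∈ (Literature.MathematicalPhysics.StatisticalMechanics.hcpPeriodicConfiguration ha hh).points, ‖p‖ ≤ 4 → ∃ j : Fin n, dist (x j) (x i + A p) ≤ θ) ∧ (∀ j : Fin n, dist (x j) (x i) ≤ 4 → ∃ p ∈ (Literature.MathematicalPhysics.StatisticalMechanics.hcpPeriodicConfiguration ha hh).points,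 dist (x j) (x i + A p) ≤ θ))} : ℝ) ≤ Literature.MathematicalPhysics.StatisticalMechanics.interactionEnergy Literature.MathematicalPhysics.StatisticalMechanics.lennardJones x + C * (L + 1) ^ 2) → ∀ δ : ℝ, 0 < δ → ∀ η : ℝ, 0 < η → ∃ κ : ℝ, 0 < κ ∧ ∃ C : ℝ, ∀ S : Set (EuclideanSpace ℝ (Fin 3)), (∀ y ∈ S, ∀ z ∈ S, y ≠ z → δ ≤ dist y z) → (∀ y ∈ S, (let d : ℝ := sInf ((fun z => dist z y) '' (S \ {y})); let T : Set (EuclideanSpace ℝ (Fin 3)) := {z : EuclideanSpace ℝ (Fin 3) | z ∈ S ∧ z ≠ y ∧ dist z y < 13 / 10 * d}; ∃ A : EuclideanSpace ℝ (Fin 3) →ₗᵢ[ℝ] EuclideanSpace ℝ (Fin 3), (∃ e : ↥T ≃ ↥Literature.Geometry.DiscreteGeometry.fccKissingPattern, ∀ t : ↥T, dist (d⁻¹ • ((t : EuclideanSpace ℝ (Fin 3)) - y)) (A ((e t : ↥Literature.Geometry.DiscreteGeometry.fccKissingPattern) : EuclideanSpace ℝ (Fin 3))) ≤ 1 / 20)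 ∨ (∃ e : ↥T ≃ ↥Literature.Geometry.DiscreteGeometry.hcpKissingPattern, ∀ t : ↥T, dist (d⁻¹ • ((t : EuclideanSpace ℝ (Fin 3)) - y)) (A ((e t : ↥Literature.Geometry.DiscreteGeometry.hcpKissingPattern) : EuclideanSpace ℝ (Fin 3))) ≤ 1 / 20))) → (∃ s : ℤ → ℤ, Literature.MathematicalPhysics.StatisticalMechanics.IsHaggSeq s ∧ ∃ Φ : EuclideanSpace ℝ (Fin 3) → EuclideanSpace ℝ (Fin 3), Set.BijOn Φ (Literature.MathematicalPhysics.StatisticalMechanics.barlowStacking 1 (Real.sqrt (2 / 3)) s) S ∧ ∀ p ∈ Literature.MathematicalPhysics.StatisticalMechanics.barlowStacking 1 (Real.sqrt (2 / 3)) s, ∃ A : EuclideanSpace ℝ (Fin 3) →ₗᵢ[ℝ] EuclideanSpace ℝ (Fin 3), ∃ l : ℝ, 0 < l ∧ ∀ q ∈ Literature.MathematicalPhysics.StatisticalMechanics.barlowStacking 1 (Real.sqrt (2 / 3)) s, dist q p ≤ 1 → dist (Φ q) (Φ p + l • A (q - p)) ≤ 1 / 20 * l) → ∀ (c : EuclideanSpace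 ℝ (Fin 3)) (L : ℝ), 0 ≤ L → 2 * ((Literature.MathematicalPhysics.StatisticalMechanics.hcpPeriodicConfiguration ha hh).energyPerParticle Literature.MathematicalPhysics.StatisticalMechanics.lennardJones) * (({y : EuclideanSpace ℝ (Fin 3) | y ∈ S ∧ dist y c ≤ L} : Set (EuclideanSpace ℝ (Fin 3))).ncard : ℝ) + κ * (({y : EuclideanSpace ℝ (Fin 3) | y ∈ S ∧ dist y c ≤ L ∧ (¬ (let d : ℝ := sInf ((fun z => dist z y) '' (S \ {y})); let T : Set (EuclideanSpace ℝ (Fin 3)) := {z : EuclideanSpace ℝ (Fin 3) | z ∈ S ∧ z ≠ y ∧ dist z y < 13 / 10 * d}; ∃ A : EuclideanSpace ℝ (Fin 3) →ₗᵢ[ℝ] EuclideanSpace ℝ (Fin 3), ∃ e : ↥T ≃ ↥Literature.Geometry.DiscreteGeometry.fccKissingPattern, ∀ t : ↥T, dist (d⁻¹ • ((t : EuclideanSpace ℝ (Fin 3)) - y)) (A ((e t : ↥Literature.Geometry.DiscreteGeometry.fccKissingPattern) : EuclideanSpace ℝ (Fin 3))) ≤ 1 / 20) ∧ ¬ (let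 T : Set (EuclideanSpace ℝ (Fin 3)) := {z : EuclideanSpace ℝ (Fin 3) | z ∈ S ∧ z ≠ y ∧ dist z y < 13 / 10 * a}; let P : Set (EuclideanSpace ℝ (Fin 3)) := {p : EuclideanSpace ℝ (Fin 3) | p ∈ Literature.MathematicalPhysics.StatisticalMechanics.hcpStacking a h ∧ p ≠ 0 ∧ ‖p‖ < 13 / 10 * a}; ∃ A : EuclideanSpace ℝ (Fin 3) →ₗᵢ[ℝ] EuclideanSpace ℝ (Fin 3), ∃ e : ↥T ≃ ↥P, ∀ t : ↥T, dist ((t : EuclideanSpace ℝ (Fin 3)) - y) (A ((e t : ↥P) : EuclideanSpace ℝ (Fin 3))) ≤ η))} : Set (EuclideanSpace ℝ (Fin 3))).ncard : ℝ) - C * (L + 1) ^ 2 ≤ (∑' y : ↥{y : EuclideanSpace ℝ (Fin 3) | y ∈ S ∧ dist y c ≤ L}, (∑' z : ↥{z : EuclideanSpace ℝ (Fin 3) | z ∈ S ∧ z ≠ (y : EuclideanSpace ℝ (Fin 3))}, Literature.MathematicalPhysics.StatisticalMechanics.lennardJones (dist (y : EuclideanSpace ℝ (Fin 3)) (z : EuclideanSpace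 ℝ (Fin 3))))) := by
  intro a h ha hh henc hK δ hδ η hη
  obtain ⟨θ, hθ, hgeo⟩ := stub_shellGeometry a h ha hh henc.1 henc.2 δ hδ η hη
  obtain ⟨κ, hκ, C, hC⟩ := masterT_at stub_boundaryLayer a h ha hh henc hK δ hδ θ hθ
    (fun S y => ¬ (let d : ℝ := sInf ((fun z => dist z y) '' (S \ {y})); let T : Set (EuclideanSpace ℝ (Fin 3)) := {z : EuclideanSpace ℝ (Fin 3) | z ∈ S ∧ z ≠ y ∧ dist z y < 13 / 10 * d}; ∃ A : EuclideanSpace ℝ (Fin 3) →ₗᵢ[ℝ] EuclideanSpace ℝ (Fin 3), ∃ e : ↥T ≃ ↥Literature.Geometry.DiscreteGeometry.fccKissingPattern, ∀ t : ↥T, dist (d⁻¹ • ((t : EuclideanSpace ℝ (Fin 3)) - y)) (A ((e t : ↥Literature.Geometry.DiscreteGeometry.fccKissingPattern) : EuclideanSpace ℝ (Fin 3))) ≤ 1 / 20) ∧ ¬ (let T : Set (EuclideanSpace ℝ (Fin 3)) := {z : EuclideanSpace ℝ (Fin 3) | z ∈ S ∧ z ≠ y ∧ dist z y < 13 / 10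 * a}; let P : Set (EuclideanSpace ℝ (Fin 3)) := {p : EuclideanSpace ℝ (Fin 3) | p ∈ Literature.MathematicalPhysics.StatisticalMechanics.hcpStacking a h ∧ p ≠ 0 ∧ ‖p‖ < 13 / 10 * a}; ∃ A : EuclideanSpace ℝ (Fin 3) →ₗᵢ[ℝ] EuclideanSpace ℝ (Fin 3), ∃ e : ↥T ≃ ↥P, ∀ t : ↥T, dist ((t : EuclideanSpace ℝ (Fin 3)) - y) (A ((e t : ↥P) : EuclideanSpace ℝ (Fin 3))) ≤ η))
    (fun S hS y hy hGd hbad => hbad.2 (hgeo S hS y hy hGd).1)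
  exact ⟨κ, hκ, C, hC⟩

/-- **Crux B from templated coercivity at an enclosed `(a,h)`** (B's witness is that `(a,h)`): the N- and E-type
inequalities at `(a,h)` are averaged on the finite window by `priced_union_bound`. [folklore] -/
theorem HcpLandscapeGap_of_templatedCoercivityAt :
    ∀ (a h : ℝ) (ha : a ≠ 0) (hh : h ≠ 0), (|a - 97129 / 100000| ≤ 1 / 10000 ∧ |h - 79294 / 100000| ≤ 1 / 10000) → (∀ δ θ : ℝ, 0 < δ → 0 < θ → ∃ κ : ℝ, 0 < κ ∧ ∃ C : ℝ, ∀ S : Set (EuclideanSpace ℝ (Fin 3)), (∀ y ∈ S, ∀ z ∈ S, y ≠ z → δ ≤ dist y z) → (∀ y ∈ S, (let d : ℝ := sInf ((fun z => dist z y) '' (S \ {y})); let T : Set (EuclideanSpace ℝ (Fin 3)) := {z : EuclideanSpace ℝ (Fin 3) | z ∈ S ∧ z ≠ y ∧ dist z y < 13 / 10 * d}; ∃ A : EuclideanSpace ℝ (Fin 3) →ₗᵢ[ℝ] EuclideanSpace ℝ (Fin 3), (∃ e : ↥T ≃ ↥Literature.Geometry.DiscreteGeometry.fccKissingPattern, ∀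 t : ↥T, dist (d⁻¹ • ((t : EuclideanSpace ℝ (Fin 3)) - y)) (A ((e t : ↥Literature.Geometry.DiscreteGeometry.fccKissingPattern) : EuclideanSpace ℝ (Fin 3))) ≤ 1 / 20) ∨ (∃ e : ↥T ≃ ↥Literature.Geometry.DiscreteGeometry.hcpKissingPattern, ∀ t : ↥T, dist (d⁻¹ • ((t : EuclideanSpace ℝ (Fin 3)) - y)) (A ((e t : ↥Literature.Geometry.DiscreteGeometry.hcpKissingPattern) : EuclideanSpace ℝ (Fin 3))) ≤ 1 / 20))) → (∃ s : ℤ → ℤ, Literature.MathematicalPhysics.StatisticalMechanics.IsHaggSeq s ∧ ∃ Φ : EuclideanSpace ℝ (Fin 3) → EuclideanSpace ℝ (Fin 3), Set.BijOn Φ (Literature.MathematicalPhysics.StatisticalMechanics.barlowStacking 1 (Real.sqrt (2 / 3)) s) S ∧ ∀ p ∈ Literature.MathematicalPhysics.StatisticalMechanics.barlowStacking 1 (Real.sqrt (2 / 3)) s, ∃ A : EuclideanSpace ℝ (Fin 3) →ₗᵢ[ℝ] EuclideanSpace ℝ (Fin 3), ∃ l : ℝ, 0 < l ∧ ∀ q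 ∈ Literature.MathematicalPhysics.StatisticalMechanics.barlowStacking 1 (Real.sqrt (2 / 3)) s, dist q p ≤ 1 → dist (Φ q) (Φ p + l • A (q - p)) ≤ 1 / 20 * l) → ∀ (c : EuclideanSpace ℝ (Fin 3)) (L : ℝ), 0 ≤ L → ∀ (n : ℕ) (x : Fin n → EuclideanSpace ℝ (Fin 3)), Function.Injective x → Set.range x = {y : EuclideanSpace ℝ (Fin 3) | y ∈ S ∧ dist y c ≤ L} → (n : ℝ) * (Literature.MathematicalPhysics.StatisticalMechanics.hcpPeriodicConfiguration ha hh).energyPerParticle Literature.MathematicalPhysics.StatisticalMechanics.lennardJones + κ * (Nat.card {i : Fin n // ¬ (∃ A : EuclideanSpace ℝ (Fin 3) →ₗᵢ[ℝ] EuclideanSpace ℝ (Fin 3), (∀ p ∈ (Literature.MathematicalPhysics.StatisticalMechanics.hcpPeriodicConfiguration ha hh).points, ‖p‖ ≤ 4 → ∃ j : Fin n, dist (x j) (x i + A p) ≤ θ) ∧ (∀ j : Fin n, dist (x j) (x i) ≤ 4 → ∃ p ∈ (Literature.MathematicalPhysics.StatisticalMechanics.hcpPeriodicConfiguration ha hh).points,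 dist (x j) (x i + A p) ≤ θ))} : ℝ) ≤ Literature.MathematicalPhysics.StatisticalMechanics.interactionEnergy Literature.MathematicalPhysics.StatisticalMechanics.lennardJones x + C * (L + 1) ^ 2) → Summit.AtomisticToContinuum.Crystallization.Theses.HullExactificationCascade.HcpLandscapeGap := by
  intro a h ha hh henc hK
  refine ⟨a, h, ha, hh, BoxMinimiser.enclosure_mem_box henc.1 henc.2, ?_⟩
  intro δ hδ η hη
  obtain ⟨κ₁, hκ₁, C₁, h₁⟩ := stackingFaultPrice_at_of_templated a h ha hh henc hK δ hδ
  obtain ⟨κ₂, hκ₂, C₂, h₂⟩ := elasticCoercivity_at_of_templated a h ha hh henc hK δ hδ η hη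
  refine ⟨min κ₁ κ₂ / 2, by positivity, (C₁ + C₂) / 2, ?_⟩
  intro S hsep hgood htempl c L hL
  have i₁ := h₁ S hsep hgood htempl c L hL
  have i₂ := h₂ S hsep hgood htempl c L hL
  have hfin : ({y : EuclideanSpace ℝ (Fin 3) | y ∈ S ∧ dist y c ≤ L} : Set (EuclideanSpace ℝ (Fin 3))).Finite :=
    Literature.MathematicalPhysics.StatisticalMechanics.finite_of_forall_le_dist_of_subset_closedBall hδ
      (fun p hp q hq hpq => hsep p hp.1 q hq.1 hpq) (c := c) (R := L)
      (fun p hp => Metric.mem_closedBall.2 hp.2)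
  exact priced_union_bound hfin hκ₁ hκ₂ i₁ i₂

/-- **Crux B from templated defect-counting coercivity at the box minimiser** (inline vocabulary): the landed box
minimiser `stub_boxMinimiser` is the witness, `stub_boxMinimiserRigid` encloses it. [folklore] -/
theorem HcpLandscapeGap_of_templatedCoercivityInline : (∀ (a h : ℝ) (ha : a ≠ 0) (hh : h ≠ 0), (9 / 10 < a ∧ a < 1 ∧ |h - a * Real.sqrt (2 / 3)| ≤ a / 100) → (∀ a' h' : ℝ, ∀ ha' : a' ≠ 0, ∀ hh' : h' ≠ 0, (9 / 10 < a' ∧ a' < 1 ∧ |h' - a' * Real.sqrt (2 / 3)| ≤ a' / 100) → (Literature.MathematicalPhysics.StatisticalMechanics.hcpPeriodicConfiguration ha hh).energyPerParticle Literature.MathematicalPhysics.StatisticalMechanics.lennardJones ≤ (Literature.MathematicalPhysics.StatisticalMechanics.hcpPeriodicConfiguration ha' hh').energyPerParticle Literature.MathematicalPhysics.StatisticalMechanics.lennardJones) → (∀ δ θ : ℝ, 0 < δ → 0 < θ → ∃ κ : ℝ, 0 < κ ∧ ∃ C : ℝ, ∀ S : Set (EuclideanSpace ℝ (Fin 3)),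 (∀ y ∈ S, ∀ z ∈ S, y ≠ z → δ ≤ dist y z) → (∀ y ∈ S, (let d : ℝ := sInf ((fun z => dist z y) '' (S \ {y})); let T : Set (EuclideanSpace ℝ (Fin 3)) := {z : EuclideanSpace ℝ (Fin 3) | z ∈ S ∧ z ≠ y ∧ dist z y < 13 / 10 * d}; ∃ A : EuclideanSpace ℝ (Fin 3) →ₗᵢ[ℝ] EuclideanSpace ℝ (Fin 3), (∃ e : ↥T ≃ ↥Literature.Geometry.DiscreteGeometry.fccKissingPattern, ∀ t : ↥T, dist (d⁻¹ • ((t : EuclideanSpace ℝ (Fin 3)) - y)) (A ((e t : ↥Literature.Geometry.DiscreteGeometry.fccKissingPattern) : EuclideanSpace ℝ (Fin 3))) ≤ 1 / 20) ∨ (∃ e : ↥T ≃ ↥Literature.Geometry.DiscreteGeometry.hcpKissingPattern, ∀ t : ↥T, dist (d⁻¹ • ((t : EuclideanSpace ℝ (Fin 3)) - y)) (A ((e t : ↥Literature.Geometry.DiscreteGeometry.hcpKissingPattern) : EuclideanSpace ℝ (Fin 3))) ≤ 1 / 20))) → (∃ s : ℤ → ℤ, Literature.MathematicalPhysics.StatisticalMechanics.IsHaggSeq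 s ∧ ∃ Φ : EuclideanSpace ℝ (Fin 3) → EuclideanSpace ℝ (Fin 3), Set.BijOn Φ (Literature.MathematicalPhysics.StatisticalMechanics.barlowStacking 1 (Real.sqrt (2 / 3)) s) S ∧ ∀ p ∈ Literature.MathematicalPhysics.StatisticalMechanics.barlowStacking 1 (Real.sqrt (2 / 3)) s, ∃ A : EuclideanSpace ℝ (Fin 3) →ₗᵢ[ℝ] EuclideanSpace ℝ (Fin 3), ∃ l : ℝ, 0 < l ∧ ∀ q ∈ Literature.MathematicalPhysics.StatisticalMechanics.barlowStacking 1 (Real.sqrt (2 / 3)) s, dist q p ≤ 1 → dist (Φ q) (Φ p + l • A (q - p)) ≤ 1 / 20 * l) → ∀ (c : EuclideanSpace ℝ (Fin 3)) (L : ℝ), 0 ≤ L → ∀ (n : ℕ) (x : Fin n → EuclideanSpace ℝ (Fin 3)), Function.Injective x → Set.range x = {y : EuclideanSpace ℝ (Fin 3) | y ∈ S ∧ dist y c ≤ L} → (n : ℝ) * (Literature.MathematicalPhysics.StatisticalMechanics.hcpPeriodicConfiguration ha hh).energyPerParticle Literature.MathematicalPhysics.StatisticalMechanics.lennardJones + κ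 * (Nat.card {i : Fin n // ¬ (∃ A : EuclideanSpace ℝ (Fin 3) →ₗᵢ[ℝ] EuclideanSpace ℝ (Fin 3), (∀ p ∈ (Literature.MathematicalPhysics.StatisticalMechanics.hcpPeriodicConfiguration ha hh).points, ‖p‖ ≤ 4 → ∃ j : Fin n, dist (x j) (x i + A p) ≤ θ) ∧ (∀ j : Fin n, dist (x j) (x i) ≤ 4 → ∃ p ∈ (Literature.MathematicalPhysics.StatisticalMechanics.hcpPeriodicConfiguration ha hh).points, dist (x j) (x i + A p) ≤ θ))} : ℝ) ≤ Literature.MathematicalPhysics.StatisticalMechanics.interactionEnergy Literature.MathematicalPhysics.StatisticalMechanics.lennardJones x + C * (L + 1) ^ 2)) → Summit.AtomisticToContinuum.Crystallization.Theses.HullExactificationCascade.HcpLandscapeGap := by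
  intro hK
  obtain ⟨a, h, ha, hh, hbox, hmin⟩ := stub_boxMinimiser
  exact HcpLandscapeGap_of_templatedCoercivityAt a h ha hh (stub_boxMinimiserRigid a h ha hh hbox hmin).1
    (hK a h ha hh hbox hmin)

/-- **Registered stub `HcpLandscapeGap_of_templatedCoercivity` of the skeleton of crux stmt-12087** — crux B from
templated defect-counting coercivity at the box minimiser, the admissibility of `S` written with `Sep`, `Good`,
`idealStacking`, `LocSim` of `HullExactificationCascadeRobustBarlowTemplateDefs` (definitionally the route decl's
inline clauses). [folklore] -/
theorem HcpLandscapeGap_of_templatedCoercivity : (∀ (a h : ℝ) (ha : a ≠ 0) (hh : h ≠ 0), (9 / 10 < a ∧ a < 1 ∧ |h - a * Real.sqrt (2 / 3)| ≤ a / 100) → (∀ a' h' : ℝ, ∀ ha' : a' ≠ 0, ∀ hh' : h' ≠ 0, (9 / 10 < a' ∧ a' < 1 ∧ |h' - a' * Real.sqrt (2 / 3)| ≤ a' / 100) → (Literature.MathematicalPhysics.StatisticalMechanics.hcpPeriodicConfiguration ha hh).energyPerParticle Literature.MathematicalPhysics.StatisticalMechanics.lennardJones ≤ (Literature.MathematicalPhysics.StatisticalMechanics.hcpPeriodicConfiguration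 ha' hh').energyPerParticle Literature.MathematicalPhysics.StatisticalMechanics.lennardJones) → (∀ δ θ : ℝ, 0 < δ → 0 < θ → ∃ κ : ℝ, 0 < κ ∧ ∃ C : ℝ, ∀ S : Set (EuclideanSpace ℝ (Fin 3)), Summit.AtomisticToContinuum.Crystallization.Theorems.HullExactificationCascadeRobustBarlowTemplate.Sep δ S → (∀ y ∈ S, Summit.AtomisticToContinuum.Crystallization.Theorems.HullExactificationCascadeRobustBarlowTemplate.Good S y) → (∃ s : ℤ → ℤ, Literature.MathematicalPhysics.StatisticalMechanics.IsHaggSeq s ∧ ∃ Φ : EuclideanSpace ℝ (Fin 3) → EuclideanSpace ℝ (Fin 3), Set.BijOn Φ (Summit.AtomisticToContinuum.Crystallization.Theorems.HullExactificationCascadeRobustBarlowTemplate.idealStacking s) S ∧ Summit.AtomisticToContinuum.Crystallization.Theorems.HullExactificationCascadeRobustBarlowTemplate.LocSim s Φ) → ∀ (c : EuclideanSpace ℝ (Fin 3)) (L : ℝ), 0 ≤ L → ∀ (n : ℕ) (x : Fin n → EuclideanSpace ℝ (Fin 3)), Function.Injective x → Set.range x = {y : EuclideanSpace ℝ (Fin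 3) | y ∈ S ∧ dist y c ≤ L} → (n : ℝ) * (Literature.MathematicalPhysics.StatisticalMechanics.hcpPeriodicConfiguration ha hh).energyPerParticle Literature.MathematicalPhysics.StatisticalMechanics.lennardJones + κ * (Nat.card {i : Fin n // ¬ (∃ A : EuclideanSpace ℝ (Fin 3) →ₗᵢ[ℝ] EuclideanSpace ℝ (Fin 3), (∀ p ∈ (Literature.MathematicalPhysics.StatisticalMechanics.hcpPeriodicConfiguration ha hh).points, ‖p‖ ≤ 4 → ∃ j : Fin n, dist (x j) (x i + A p) ≤ θ) ∧ (∀ j : Fin n, dist (x j) (x i) ≤ 4 → ∃ p ∈ (Literature.MathematicalPhysics.StatisticalMechanics.hcpPeriodicConfiguration ha hh).points, dist (x j) (x i + A p) ≤ θ))} : ℝ) ≤ Literature.MathematicalPhysics.StatisticalMechanics.interactionEnergy Literature.MathematicalPhysics.StatisticalMechanics.lennardJones x + C * (L + 1) ^ 2)) → Summit.AtomisticToContinuum.Crystallization.Theses.HullExactificationCascade.HcpLandscapeGap :=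
  fun hK => HcpLandscapeGap_of_templatedCoercivityInline hK

/-- The templated hypothesis is WEAKER than the pair of sibling cruxes: `HcpBulkFloor → HcpDefectCoercivity →`
(templated coercivity at every box minimiser), with allowance `C = 0` — the unrestricted floor is moved to the
minimiser by its global minimality (`stub_boxMinimiserRigid`), 14476 is applied there, and the window inherits the
separation of `S`. [folklore] -/
theorem templatedCoercivity_of_hcpDefectCounting :
    Summit.AtomisticToContinuum.Crystallization.Theses.HcpDefectCounting.HcpBulkFloor →
    Summit.AtomisticToContinuum.Crystallization.Theses.HcpDefectCounting.HcpDefectCoercivity → (∀ (a h : ℝ) (ha : a ≠ 0) (hh : h ≠ 0), (9 / 10 < a ∧ a < 1 ∧ |h - a * Real.sqrt (2 / 3)| ≤ a / 100) → (∀ a' h' : ℝ, ∀ ha' : a' ≠ 0, ∀ hh' : h' ≠ 0, (9 / 10 < a' ∧ a' < 1 ∧ |h' - a' * Real.sqrt (2 / 3)| ≤ a' / 100) → (Literature.MathematicalPhysics.StatisticalMechanics.hcpPeriodicConfiguration ha hh).energyPerParticle Literature.MathematicalPhysics.StatisticalMechanics.lennardJones ≤ (Literature.MathematicalPhysics.StatisticalMechanics.hcpPeriodicConfiguration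 ha' hh').energyPerParticle Literature.MathematicalPhysics.StatisticalMechanics.lennardJones) → (∀ δ θ : ℝ, 0 < δ → 0 < θ → ∃ κ : ℝ, 0 < κ ∧ ∃ C : ℝ, ∀ S : Set (EuclideanSpace ℝ (Fin 3)), (∀ y ∈ S, ∀ z ∈ S, y ≠ z → δ ≤ dist y z) → (∀ y ∈ S, (let d : ℝ := sInf ((fun z => dist z y) '' (S \ {y})); let T : Set (EuclideanSpace ℝ (Fin 3)) := {z : EuclideanSpace ℝ (Fin 3) | z ∈ S ∧ z ≠ y ∧ dist z y < 13 / 10 * d}; ∃ A : EuclideanSpace ℝ (Fin 3) →ₗᵢ[ℝ] EuclideanSpace ℝ (Fin 3), (∃ e : ↥T ≃ ↥Literature.Geometry.DiscreteGeometry.fccKissingPattern, ∀ t : ↥T, dist (d⁻¹ • ((t : EuclideanSpace ℝ (Fin 3)) - y)) (A ((e t : ↥Literature.Geometry.DiscreteGeometry.fccKissingPattern) : EuclideanSpace ℝ (Fin 3))) ≤ 1 / 20) ∨ (∃ e : ↥T ≃ ↥Literature.Geometry.DiscreteGeometry.hcpKissingPattern, ∀ t : ↥T, dist (d⁻¹ •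 ((t : EuclideanSpace ℝ (Fin 3)) - y)) (A ((e t : ↥Literature.Geometry.DiscreteGeometry.hcpKissingPattern) : EuclideanSpace ℝ (Fin 3))) ≤ 1 / 20))) → (∃ s : ℤ → ℤ, Literature.MathematicalPhysics.StatisticalMechanics.IsHaggSeq s ∧ ∃ Φ : EuclideanSpace ℝ (Fin 3) → EuclideanSpace ℝ (Fin 3), Set.BijOn Φ (Literature.MathematicalPhysics.StatisticalMechanics.barlowStacking 1 (Real.sqrt (2 / 3)) s) S ∧ ∀ p ∈ Literature.MathematicalPhysics.StatisticalMechanics.barlowStacking 1 (Real.sqrt (2 / 3)) s, ∃ A : EuclideanSpace ℝ (Fin 3) →ₗᵢ[ℝ] EuclideanSpace ℝ (Fin 3), ∃ l : ℝ, 0 < l ∧ ∀ q ∈ Literature.MathematicalPhysics.StatisticalMechanics.barlowStacking 1 (Real.sqrt (2 / 3)) s, dist q p ≤ 1 → dist (Φ q) (Φ p + l • A (q - p)) ≤ 1 / 20 * l) → ∀ (c : EuclideanSpace ℝ (Fin 3)) (L : ℝ), 0 ≤ L → ∀ (n : ℕ) (x : Fin n → EuclideanSpace ℝ (Fin 3)),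 Function.Injective x → Set.range x = {y : EuclideanSpace ℝ (Fin 3) | y ∈ S ∧ dist y c ≤ L} → (n : ℝ) * (Literature.MathematicalPhysics.StatisticalMechanics.hcpPeriodicConfiguration ha hh).energyPerParticle Literature.MathematicalPhysics.StatisticalMechanics.lennardJones + κ * (Nat.card {i : Fin n // ¬ (∃ A : EuclideanSpace ℝ (Fin 3) →ₗᵢ[ℝ] EuclideanSpace ℝ (Fin 3), (∀ p ∈ (Literature.MathematicalPhysics.StatisticalMechanics.hcpPeriodicConfiguration ha hh).points, ‖p‖ ≤ 4 → ∃ j : Fin n, dist (x j) (x i + A p) ≤ θ) ∧ (∀ j : Fin n, dist (x j) (x i) ≤ 4 → ∃ p ∈ (Literature.MathematicalPhysics.StatisticalMechanics.hcpPeriodicConfiguration ha hh).points, dist (x j) (x i + A p) ≤ θ))} : ℝ) ≤ Literature.MathematicalPhysics.StatisticalMechanics.interactionEnergy Literature.MathematicalPhysics.StatisticalMechanics.lennardJones x + C * (L + 1) ^ 2)) := by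
  intro hF hK a h ha hh hbox hmin δ θ hδ hθ
  obtain ⟨henc, hglob⟩ := stub_boxMinimiserRigid a h ha hh hbox hmin
  obtain ⟨hea, heh⟩ := henc
  obtain ⟨ha1, ha2⟩ := abs_le.1 hea
  obtain ⟨hh1, hh2⟩ := abs_le.1 heh
  have hb1 : (47 : ℝ) / 50 ≤ a := by linarith
  have hb2 : a ≤ 1 := by linarith
  have hb3 : 39 / 50 * a ≤ h := by linarith
  have hb4 : h ≤ 17 / 20 * a := by linarith
  obtain ⟨a₁, h₁, ha₁, hh₁, hc₁, -, hc₃, -, hfloor₁⟩ := hF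
  have ha₁pos : 0 < a₁ := by linarith
  have hh₁pos : 0 < h₁ := by linarith
  have hfloor : ∀ (N : ℕ) (x : Fin N → EuclideanSpace ℝ (Fin 3)), Function.Injective x →
      (N : ℝ) * (Literature.MathematicalPhysics.StatisticalMechanics.hcpPeriodicConfiguration ha hh).energyPerParticle
          Literature.MathematicalPhysics.StatisticalMechanics.lennardJones ≤
        Literature.MathematicalPhysics.StatisticalMechanics.interactionEnergy
          Literature.MathematicalPhysics.StatisticalMechanics.lennardJones x := by
    intro N x hx
    have h1 := hglob a₁ h₁ ha₁ hh₁ ha₁pos hh₁pos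
    have h2 := hfloor₁ N x hx
    have hN : (0 : ℝ) ≤ N := Nat.cast_nonneg N
    nlinarith
  obtain ⟨κ, hκ, hcoer⟩ := hK a h ha hh hb1 hb2 hb3 hb4 hfloor δ θ hδ hθ
  refine ⟨κ, hκ, 0, ?_⟩
  intro S hsep _ _ c L _ n x hx hrange
  have hxsep : ∀ i j : Fin n, i ≠ j → δ ≤ dist (x i) (x j) := fun i j hij =>
    hsep _ (hrange ▸ Set.mem_range_self i).1 _ (hrange ▸ Set.mem_range_self j).1 (fun h0 => hij (hx h0))
  have := hcoer n x hxsep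
  linarith

end Summit.AtomisticToContinuum.Crystallization.Theorems.HcpLandscapeGapBirth
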